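import Mathlib
import Literature.Analysis.Fourier.FractalUncertaintyHarmonicBound

/-!
# Poisson–Jensen localisation step (solo-informed, session 24; claim C203, sharpest §2e (D12)(ii))

The exponent bookkeeping behind the GM–Poisson localisation inequality
`|F(γ+iη)|² ≤ e^{2aη} · M^{ε} · (A_K/(1-ε))^{1-ε}`:
given the Nevanlinna input `log|F(γ+iη)|² ≤ 2aη + ∫ log|F|² dP` (half-plane potential theory,
not formalised here), everything else is the following measure-theoretic inequality for a
finite measure `μ`, a measurable "near" set `N` and a positive function `h` (`= |F|²`) bounded
by `M` off `N`:  `∫ log h dμ ≤ μ(Nᶜ)·log M + μ(N)·log(∫_N h dμ / μ(N))`.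
The near part is Jensen for `log` proved from the tangent line `log x ≤ log c + x/c - 1`
(the landed `Literature.Analysis.Fourier.SlitStrip.log_le_log_add_div_sub_one`, so no lower bound on
`h` is needed); the far part is monotonicity of `log`.
Hypotheses carry the integrability binders that make `∫` meaningful (no junk values).
ADDITIVE FORM (appended, session 24): weighted AM–GM `y^{1-ε} ≤ τ^{-ε}((1-ε)y + ετ)` turns the
bound into `exp (∫ log h dμ) ≤ M^ε · τ^{-ε} · (∫_N h dμ + ε τ)` for every `τ > 0` — multiplicative
`M^ε τ^{-ε}` on the near mass, additive leak `ε τ` (the shape used in (D12)(ii)).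
-/

namespace Summit.RiemannHypothesis.RiemannHypothesis.Theorems

open MeasureTheory Set

/-- Jensen step on the near set, with no lower bound on `h`: if `0 < h` on a measurable set
`N` of finite positive mass, `h` and `log ∘ h` are integrable on `N`, and `0 < ∫_N h`, then
`∫_N log h dμ ≤ μ(N) · log (∫_N h dμ / μ(N))`. -/
theorem setIntegral_log_le_mass_mul_log_mean {α : Type*} [MeasurableSpace α]
    {μ : Measure α} {N : Set α} (hN : MeasurableSet N) (hμN : μ N ≠ ⊤)
    (hm : 0 < (μ N).toReal) {h : α → ℝ} (hpos : ∀ x ∈ N, 0 < h x)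
    (hint : IntegrableOn h N μ) (hlog : IntegrableOn (fun x => Real.log (h x)) N μ)
    (hA : 0 < ∫ x in N, h x ∂μ) :
    ∫ x in N, Real.log (h x) ∂μ
      ≤ (μ N).toReal * Real.log ((∫ x in N, h x ∂μ) / (μ N).toReal) := by
  obtain ⟨c, hc_def⟩ : ∃ c : ℝ, c = (∫ x in N, h x ∂μ) / (μ N).toReal := ⟨_, rfl⟩
  have hc : 0 < c := by rw [hc_def]; exact div_pos hA hm
  have hpt : ∀ x ∈ N, Real.log (h x) ≤ (Real.log c - 1) + h x / c := by
    intro x hx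
    have := Literature.Analysis.Fourier.SlitStrip.log_le_log_add_div_sub_one (hpos x hx) hc
    linarith
  have hI1 : IntegrableOn (fun _ : α => Real.log c - 1) N μ := integrableOn_const hμN
  have hI2 : IntegrableOn (fun x => h x / c) N μ := hint.div_const _
  have hI : IntegrableOn (fun x => (Real.log c - 1) + h x / c) N μ := hI1.add hI2
  have hcc : (∫ x in N, h x ∂μ) / c = (μ N).toReal := by
    rw [hc_def]
    have hA0 : (∫ x in N, h x ∂μ) ≠ 0 := hA.ne'
    have hm0 : (μ N).toReal ≠ 0 := hm.ne'
    field_simp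
  calc ∫ x in N, Real.log (h x) ∂μ
      ≤ ∫ x in N, ((Real.log c - 1) + h x / c) ∂μ := setIntegral_mono_on hlog hI hN hpt
    _ = (∫ x in N, (Real.log c - 1) ∂μ) + ∫ x in N, h x / c ∂μ := integral_add hI1 hI2
    _ = (μ N).toReal * (Real.log c - 1) + (∫ x in N, h x ∂μ) / c := by
        rw [setIntegral_const, smul_eq_mul, measureReal_def, integral_div]
    _ = (μ N).toReal * Real.log c := by rw [hcc]; ring
    _ = (μ N).toReal * Real.log ((∫ x in N, h x ∂μ) / (μ N).toReal) := by rw [hc_def]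

/-- Far part: if `0 < h ≤ M` on a measurable set `S` of finite mass and `log ∘ h` is integrable
on `S`, then `∫_S log h dμ ≤ μ(S) · log M`. -/
theorem setIntegral_log_le_mass_mul_log_bound {α : Type*} [MeasurableSpace α]
    {μ : Measure α} {S : Set α} (hS : MeasurableSet S) (hμS : μ S ≠ ⊤)
    {h : α → ℝ} {M : ℝ} (hpos : ∀ x ∈ S, 0 < h x) (hle : ∀ x ∈ S, h x ≤ M)
    (hlog : IntegrableOn (fun x => Real.log (h x)) S μ) :
    ∫ x in S, Real.log (h x) ∂μ ≤ (μ S).toReal * Real.log M := by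
  have hI : IntegrableOn (fun _ : α => Real.log M) S μ := integrableOn_const hμS
  calc ∫ x in S, Real.log (h x) ∂μ ≤ ∫ x in S, Real.log M ∂μ :=
        setIntegral_mono_on hlog hI hS (fun x hx => Real.log_le_log (hpos x hx) (hle x hx))
    _ = (μ S).toReal * Real.log M := by rw [setIntegral_const, smul_eq_mul, measureReal_def]

/-- LOCALISATION BOOKKEEPING (the measure-theoretic content of the GM–Poisson step): for a
finite measure `μ`, a measurable near set `N` with `0 < μ N`, and `h > 0` everywhere with
`h` and `log ∘ h` integrable and `h ≤ M` off `N`: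
`∫ log h dμ ≤ μ(Nᶜ)·log M + μ(N)·log(∫_N h dμ / μ(N))`. -/
theorem integral_log_le_far_add_near {α : Type*} [MeasurableSpace α]
    {μ : Measure α} [IsFiniteMeasure μ] {N : Set α} (hN : MeasurableSet N)
    (hm : 0 < (μ N).toReal) {h : α → ℝ} {M : ℝ} (hpos : ∀ x, 0 < h x)
    (hle : ∀ x ∈ Nᶜ, h x ≤ M) (hint : Integrable h μ)
    (hlog : Integrable (fun x => Real.log (h x)) μ) (hA : 0 < ∫ x in N, h x ∂μ) :
    ∫ x, Real.log (h x) ∂μ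
      ≤ (μ Nᶜ).toReal * Real.log M
        + (μ N).toReal * Real.log ((∫ x in N, h x ∂μ) / (μ N).toReal) := by
  have hsplit := integral_add_compl hN hlog
  rw [← hsplit, add_comm]
  apply add_le_add
  · exact setIntegral_log_le_mass_mul_log_bound hN.compl (measure_ne_top μ _)
      (fun x _ => hpos x) hle hlog.integrableOn
  · exact setIntegral_log_le_mass_mul_log_mean hN (measure_ne_top μ _) hm
      (fun x _ => hpos x) hint.integrableOn hlog.integrableOn hA

/-- Exponentiated form for a probability measure (the shape used in (D12)(ii)): with
`ε = μ(Nᶜ)` and `1 - ε = μ(N)`, `exp (∫ log h dμ) ≤ M ^ ε * (∫_N h dμ / (1-ε)) ^ (1-ε)`,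
where `M > 0`. -/
theorem exp_integral_log_le_rpow_mul_rpow {α : Type*} [MeasurableSpace α]
    {μ : Measure α} [IsProbabilityMeasure μ] {N : Set α} (hN : MeasurableSet N)
    (hm : 0 < (μ N).toReal) {h : α → ℝ} {M : ℝ} (hM : 0 < M) (hpos : ∀ x, 0 < h x)
    (hle : ∀ x ∈ Nᶜ, h x ≤ M) (hint : Integrable h μ)
    (hlog : Integrable (fun x => Real.log (h x)) μ) (hA : 0 < ∫ x in N, h x ∂μ) :
    Real.exp (∫ x, Real.log (h x) ∂μ)
      ≤ M ^ (μ Nᶜ).toReal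
        * ((∫ x in N, h x ∂μ) / (μ N).toReal) ^ (μ N).toReal := by
  have h1 := integral_log_le_far_add_near hN hm hpos hle hint hlog hA
  have hq : 0 < (∫ x in N, h x ∂μ) / (μ N).toReal := div_pos hA hm
  calc Real.exp (∫ x, Real.log (h x) ∂μ)
      ≤ Real.exp ((μ Nᶜ).toReal * Real.log M
          + (μ N).toReal * Real.log ((∫ x in N, h x ∂μ) / (μ N).toReal)) :=
        Real.exp_le_exp.2 h1
    _ = M ^ (μ Nᶜ).toReal * ((∫ x in N, h x ∂μ) / (μ N).toReal) ^ (μ N).toReal := by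
        rw [Real.exp_add, Real.rpow_def_of_pos hM, Real.rpow_def_of_pos hq, mul_comm (Real.log M),
          mul_comm (Real.log _)]

/-- Weighted AM–GM in "additive conversion" form: for `0 ≤ y`, `0 < τ`, `0 ≤ ε ≤ 1`,
`y ^ (1-ε) ≤ τ ^ (-ε) * ((1-ε) * y + ε * τ)`. -/
theorem rpow_one_sub_le_rpow_neg_mul {y τ ε : ℝ} (hy : 0 ≤ y) (hτ : 0 < τ) (hε0 : 0 ≤ ε)
    (hε1 : ε ≤ 1) : y ^ (1 - ε) ≤ τ ^ (-ε) * ((1 - ε) * y + ε * τ) := by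
  have hamgm := Real.geom_mean_le_arith_mean2_weighted (by linarith : 0 ≤ 1 - ε) hε0 hy hτ.le
    (by ring : (1 - ε) + ε = 1)
  have hτε : 0 < τ ^ ε := Real.rpow_pos_of_pos hτ ε
  have hkey : y ^ (1 - ε) = τ ^ (-ε) * (y ^ (1 - ε) * τ ^ ε) := by
    rw [Real.rpow_neg hτ.le]
    field_simp
  rw [hkey]
  exact mul_le_mul_of_nonneg_left hamgm (Real.rpow_nonneg hτ.le _)

/-- GM–POISSON BOOKKEEPING, ADDITIVE FORM: for a probability measure `μ`, a measurable near set
`N` of positive mass, `h > 0` with `h` and `log ∘ h` integrable, `h ≤ M` off `N` (`M > 0`),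
`0 < ∫_N h`, and any `τ > 0`, writing `ε = μ(Nᶜ)`:
`exp (∫ log h dμ) ≤ M ^ ε * (τ ^ (-ε) * (∫_N h dμ + ε * τ))`. -/
theorem exp_integral_log_le_additive {α : Type*} [MeasurableSpace α]
    {μ : Measure α} [IsProbabilityMeasure μ] {N : Set α} (hN : MeasurableSet N)
    (hm : 0 < (μ N).toReal) {h : α → ℝ} {M τ : ℝ} (hM : 0 < M) (hτ : 0 < τ)
    (hpos : ∀ x, 0 < h x) (hle : ∀ x ∈ Nᶜ, h x ≤ M) (hint : Integrable h μ)
    (hlog : Integrable (fun x => Real.log (h x)) μ) (hA : 0 < ∫ x in N, h x ∂μ) :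
    Real.exp (∫ x, Real.log (h x) ∂μ)
      ≤ M ^ (μ Nᶜ).toReal
        * (τ ^ (-(μ Nᶜ).toReal) * ((∫ x in N, h x ∂μ) + (μ Nᶜ).toReal * τ)) := by
  have h1 := exp_integral_log_le_rpow_mul_rpow hN hm hM hpos hle hint hlog hA
  have hsum : (μ N).toReal + (μ Nᶜ).toReal = 1 := by
    have hp := prob_add_prob_compl (μ := μ) hN
    rw [← ENNReal.toReal_add (measure_ne_top μ _) (measure_ne_top μ _), hp]
    simp
  have hmeq : (μ N).toReal = 1 - (μ Nᶜ).toReal := by linarith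
  have hε0 : 0 ≤ (μ Nᶜ).toReal := ENNReal.toReal_nonneg
  have hε1 : (μ Nᶜ).toReal ≤ 1 := by linarith [hm.le]
  have hq : 0 ≤ (∫ x in N, h x ∂μ) / (μ N).toReal := (div_pos hA hm).le
  have h2 := rpow_one_sub_le_rpow_neg_mul hq hτ hε0 hε1
  rw [← hmeq] at h2
  have hmA : (μ N).toReal * ((∫ x in N, h x ∂μ) / (μ N).toReal) = ∫ x in N, h x ∂μ := by
    field_simp
  rw [hmA] at h2
  exact h1.trans (mul_le_mul_of_nonneg_left h2 (Real.rpow_nonneg hM.le _))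

end Summit.RiemannHypothesis.RiemannHypothesis.Theorems
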